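import Literature.IUT.LogThetaLattice.LogShellIdentificationBridge
import Literature.IUT.LogVolume.TensorPacketLemmas
import HarnessLib

/-!
# Bridge (proof companion): the HOLOMORPHIC integral structures of [IUTchIII] Prop 3.1 (ii) / Rmk 3.1.1 (i)
# at the local model, and abc-iut-S1's integer packet `R_I = ⊗ 𝒪_{K_{v_α}}` ([IUTchIV] Prop 1.1)

PROOF-ONLY companion (no definitions) of `LogShellIdentificationBridge.lean` (abc-iut-w4-d019, p413505;
MERGE-MAP §1 rows 27/43/53). S. Mochizuki, *Inter-universal Teichmüller theory III*, kurims manuscript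
(May 2020), Rmk 3.1.1 (i) pp. 93–94 ("`Ψ_{log(^α𝓕_v)}` is a copy of … `𝒪 ⊆ k̄`"), Prop 3.1 (ii) p. 93, and
Rmk 3.2.1 p. 99 ("the issue of estimating the discrepancy between the holomorphic integral structures of
Proposition 3.1, (ii), and the mono-analytic integral structures of Proposition 3.2, (ii), will form one
of the main topics … in [IUTchIV]") [cite: Mochizuki2012, III Rmk 3.1.1 (i) p.93; Rmk 3.2.1 p.99]. Claim
key DISPUTED (D-0012); classical objects; no side taken on anything; nothing here bears on
[IUTchIII] Cor 3.12.

The bridge file identified abc-iut-L6-t4's MONO-ANALYTIC log-shell packets with abc-iut-S1's `log_p(R_I^×)`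
packets (`packetDecomposition_tprod_shell_mem`). THIS FILE is the holomorphic twin that Rmk 3.2.1 pairs
with it: (1) abc-iut-L6-t4's named model statement `Remark311i_model` HOLDS for the bridge's data
`(holField, integralStructureFamily)` against the model data `(K_v, 𝒪_{K_v})` (tautologically — the bridge
data IS the finite-level model); (2) on a pure tensor `⊗_α x_α` of the `n`-packet whose components are
INTEGERS (`‖x_α(v)‖ ≤ 1`, i.e. `x_α(v) ∈ 𝒪_{K_v}`), the `v⃗`-component of t4's `packetDecomposition` lies in
abc-iut-S1's integer packet `R_I = ⊗_{ℤ_p} 𝒪_{K_{v_α}}` (`LogVolume.integerPacket`, [IUTchIV] Prop 1.1) — so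
the two members of t4's `integralStructureDiscrepancyDatum` are, summand by summand, exactly the pair
(`((p*)⁻¹)^{|A|} • log_p(R_I^×)`, `R_I`) that [IUTchIV] Prop 1.2 compares.
-/

noncomputable section

namespace Literature.IUT.LogThetaLattice

namespace LogShellBridge

open Set Metric
open scoped TensorProduct
open Literature.IUT.LogVolume PiTensorProduct

variable (p : ℕ) [hp : Fact p.Prime]
variable {A : Type} {Vfib : Type}
variable (K : Vfib → Type) [∀ v, NontriviallyNormedField (K v)] [∀ v, NormedAlgebra ℚ_[p] (K v)]

/-- **IUTchIII:Rmk3.1.1(i)** (kurims p.93), abc-iut-L6-t4's named model statement `Remark311i_model`,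
HOLDS for the bridge data at the finite level: `(log(^α𝓕_v), Ψ ∪ {0}) = (K_v, 𝒪_{K_v})` is (by the
identity) isomorphic to the model data `(K_v, 𝒪_{K_v})`. [claim: Mochizuki2012, status: disputed] -/
theorem remark311i_model_holds [Fintype A] [DecidableEq A] [Fintype Vfib] [DecidableEq Vfib]
    [∀ v, IsUltrametricDist (K v)] :
    Remark311i_model ℚ_[p] (holField A K) (integralStructureFamily K A) K
      (fun v => integralStructure K v) :=
  fun _ _ => ⟨AlgEquiv.refl, fun _ => Iff.rfl⟩

/-- A pure tensor of elements of the bridge's integral structures `𝒪_{K_{v_α}}`, read in abc-iut-S1's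
packet algebra `⊗_α K_{v_α}`, lies in the integer packet `R_I` ([IUTchIV] Prop 1.1; abc-iut-S1
`purePacket_mem_integerPacket`, whose hypothesis is `‖·‖ ≤ 1`). [claim: Mochizuki2012, status: disputed] -/
theorem purePacket_mem_integerPacket_of_mem_integralStructure [Fintype A] [DecidableEq A]
    [∀ v, IsUltrametricDist (K v)] (vA : A → Vfib) (y : ∀ α, K (vA α))
    (hy : ∀ α, y α ∈ integralStructure K (vA α)) :
    LogVolume.purePacket p (fun α => K (vA α)) y ∈ LogVolume.integerPacket p (fun α => K (vA α)) :=
  LogVolume.purePacket_mem_integerPacket p (fun α => K (vA α)) fun α =>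
    (mem_integralStructure_iff K (vA α) (y α)).mp (hy α)

/-- **IUTchIII:Rmk3.1.1(ii)** / **Rmk 3.2.1** (kurims pp.95, 99) ↔ **[IUTchIV] Prop 1.1**: for a pure
tensor `⊗_α x_α` of the holomorphic `n`-packet with every component `x_α(v)` an INTEGER of `K_v`, the
`v⃗`-component of abc-iut-L6-t4's `packetDecomposition` (`= ⊗_α x_α(v_α)`) lies in abc-iut-S1's integer
packet `R_I = ⊗_{ℤ_p} 𝒪_{K_{v_α}}` — the holomorphic member of the discrepancy pair of Rmk 3.2.1, summand
by summand (its mono-analytic member is `packetDecomposition_tprod_shell_mem` of the bridge file).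
[claim: Mochizuki2012, status: disputed] -/
theorem packetDecomposition_tprod_integral_mem [Fintype A] [DecidableEq A] [Fintype Vfib]
    [DecidableEq Vfib] [∀ v, IsUltrametricDist (K v)] (x : ∀ α, Packet1 (holField A K) α)
    (hx : ∀ α v, x α v ∈ integralStructure K v) (vA : A → Vfib) :
    packetDecomposition ℚ_[p] (holField A K) (tprod ℚ_[p] x) vA ∈
      LogVolume.integerPacket p (fun α => K (vA α)) := by
  rw [packetDecomposition_tprod]
  exact purePacket_mem_integerPacket_of_mem_integralStructure p K vA (fun α => x α (vA α))
    fun α => hx α (vA α)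

end LogShellBridge

end Literature.IUT.LogThetaLattice

end
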